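import Summits.ResolutionOfSingularities.ResolutionOfSingularities.Theorems.WildConesCampaignW46ForcedAtomPermissible
import Summits.ResolutionOfSingularities.ResolutionOfSingularities.Theorems.WildConesCampaignW46ResidueField
import HarnessLib

/-!
# [OURS · L1 W4.6, rung (i)/(all `n ≥ 1`) — the dictionary, brick 17] The ONE STEP of the forced-atom rung with
# RATIONALITY AS A HYPOTHESIS, and the one step over every FINITE field
# (cell res-hironaka, LADDER-RESOLUTION rung L, D-0089; slot W4.6, seat res-L1-s46-pv-2 gen 3; host route `WildCones`,
# crux `ClassicalRegimes` stmt-ResolutionOfSingularities-16884, `--supports … --as helper`)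

HONEST FRAMING. Everything here is OURS. NOTHING below is a statement of H. Hironaka's manuscript [Hironaka2017] and
nothing asserts that any statement of it holds: the typed procedure and its résumé-free / finite-sequence forms
(`CampaignW46.Run`/`Terminates` — res-L1-type-o1; `PermissibleRun`/`PermissiblyTerminates`/`FinPermissibleRun`/
`FinLocalExitBound` — res-L1-s46-pv-1 / o1), o1's regime `Regime.forcedAtom` (p517839) and the typed candidate carriers of
row 001 enter as DEFINITIONS; no FACT-LIST premise is used. AI review is weaker than expert review.

## What is proved

The only use of algebraic closedness in this seat's dictionary is the rationality of the next singular point over the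
current one (brick 7′, inside `exists_presentation_transform_of_isBlowup`, p523688). Here:

* `exists_presentation_transform_of_rat` — the one step for raw blow-up data with rationality as an explicit HYPOTHESIS
  `hrat` (every germ at `ξ′` is congruent modulo `𝔪_{ξ′}` to a pulled-back germ), over any PERFECT field `K` of
  characteristic `p` (perfectness is used by the successor atom's cleaning, brick 8); proof verbatim that of p523688
  minus brick 7′.
* `exists_presentation_transform_of_finite` — the one step over a FINITE field `K`, given that the local ring at the next
  singular point is presented too (`𝒪̂_{ξ′} ≃+* K⟦Y⟧`, e.g. from the regime at the next stage): both residue fields are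
  then `K` and the residue extension is bijective (brick 16, `…W46ResidueField.lean`).

The rungs over finite fields follow in `…ForcedAtomFiniteField.lean`. NOT claimed: infinite perfect non-closed `K`.
References: p523688, brick 16. [cite: Matsumura1987, Thm. 8.11] [folklore]
-/

noncomputable section

-- single-problem summit: the doubled namespace component `ResolutionOfSingularities` is forced
set_option linter.dupNamespace false

open scoped BigOperators Classical
open MvPowerSeries IsLocalRing

namespace Summit.ResolutionOfSingularities.ResolutionOfSingularities.Theorems

namespace CampaignW46.ForcedAtom

open CategoryTheory AlgebraicGeometry TopologicalSpace
open Literature.AlgebraicGeometry.Resolution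
open Literature.AlgebraicGeometry.Hironaka2017.S02Preliminaries
open Literature.AlgebraicGeometry.Hironaka2017.Datum
open Scheme.IdealSheafData
open WildCones
open CampaignW46.ChartPoint CampaignW46.AtomGerm CampaignW46.FormalChart

variable {p : ℕ} [Fact p.Prime] {K : Type} [Field K] [CharP K p] {n : ℕ}

/-! ## The one step with rationality as a hypothesis -/

/-- [OURS · L1 W4.6 — the ONE STEP in the forced-atom class for raw blow-up data, RATIONALITY AS A HYPOTHESIS (no
assumption on the field); NOT a statement of the manuscript] As `exists_presentation_transform_of_isBlowup` (p523688),
for every PERFECT field `K` of characteristic `p`, assuming that the closed singular point `ξ′` of the transform is rational over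
`π ξ′` (`hrat`: every germ at `ξ′` is congruent modulo `𝔪_{ξ′}` to a pulled-back germ). [folklore] -/
theorem exists_presentation_transform_of_rat [PerfectField K] {A A' : AmbientDatum p K} (π : A'.Z ⟶ A.Z)
    (D : Closeds A.Z)
    (hπ : IsBlowup π (vanishingIdeal D)) {E : IdealExponent A.Z} (hb : E.b = p)
    (hS : E.sing.Subsingleton)
    {ξ : A.Z} (hξ : ξ ∈ E.sing) (hD : (D : Set A.Z) = {ξ}) (hd : (maximalIdeal (A.Z.presheaf.stalk ξ)).spanFinrank = n + 1)
    (E₀ : AdicCompletion (maximalIdeal (A.Z.presheaf.stalk ξ)) (A.Z.presheaf.stalk ξ) ≃+*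
      MvPowerSeries (Option (Fin n)) K)
    (f₀ : A.Z.presheaf.stalk ξ) (a : (Fin n → ℕ) → K) (w : MvPowerSeries (Option (Fin n)) K)
    (hJ : stalkIdeal E.J ξ = Ideal.span {f₀}) (hw : IsUnit w)
    (hf₀ : E₀ (algebraMap _ _ f₀) =
      w * ((X none : MvPowerSeries (Option (Fin n)) K) ^ p - rename (some : Fin n → Option (Fin n)) (ser p n K a)))
    (hM : MultP p n K a)
    {ξ' : A'.Z} (hξ' : ξ' ∈ (E.transform π D).sing)
    (hrat : ∀ y : A'.Z.presheaf.stalk ξ', ∃ r : A.Z.presheaf.stalk (π ξ'),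
      y - (π.stalkMap ξ').hom r ∈ maximalIdeal (A'.Z.presheaf.stalk ξ')) :
    ∃ (i₀ : Fin n) (t : Fin n → K)
      (E₀' : AdicCompletion (maximalIdeal (A'.Z.presheaf.stalk ξ')) (A'.Z.presheaf.stalk ξ') ≃+*
        MvPowerSeries (Option (Fin n)) K)
      (f₀' : A'.Z.presheaf.stalk ξ') (w' : MvPowerSeries (Option (Fin n)) K),
      stalkIdeal (E.transform π D).J ξ' = Ideal.span {f₀'} ∧ IsUnit w' ∧
        E₀' (algebraMap _ _ f₀') =
          w' * ((X none : MvPowerSeries (Option (Fin n)) K) ^ p -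
            rename (some : Fin n → Option (Fin n)) (ser p n K (step p n K i₀ t a))) := by
  haveI : IsLocallyNoetherian A'.Z := ambient_isLocallyNoetherian A'
  have hp : p.Prime := Fact.out
  -- the centre is the singular point, and `ξ′` lies over it
  have hDS : (D : Set A.Z) ⊆ E.sing := by
    rw [hD]
    exact Set.singleton_subset_iff.mpr hξ
  have hπξ : π ξ' = ξ := hS (sing_subset_of_transform hπ E hDS hξ') hξ
  subst hπξ
  haveI : IsRegularLocalRing (A.Z.presheaf.stalk (π ξ')) := ambient_isRegular A _
  haveI : IsRegularLocalRing (A'.Z.presheaf.stalk ξ') := ambient_isRegular A' _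
  -- the local homomorphism `g = π^♯_{ξ′}`
  have hloc : IsLocalHom (π.stalkMap ξ').hom := inferInstance
  have hg : (maximalIdeal (A.Z.presheaf.stalk (π ξ'))).map (π.stalkMap ξ').hom ≤
      maximalIdeal (A'.Z.presheaf.stalk ξ') :=
    ((IsLocalRing.local_hom_TFAE (π.stalkMap ξ').hom).out 0 2).mp hloc
  -- an adapted regular system of parameters at `π ξ′`
  obtain ⟨c, hc, hcX⟩ := exists_rsop_adapted E₀
  have hcl : IsClosed ({π ξ'} : Set A.Z) := hD ▸ D.isClosed
  have hcJ : Ideal.span (Set.range c) = stalkIdeal (vanishingIdeal D) (π ξ') := by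
    rw [hc, stalkIdeal_vanishingIdeal_eq_maximalIdeal_of_closure_eq]
    rw [hD, hcl.closure_eq]
  -- chart data of the blow-up at `ξ′`
  have hd' : (maximalIdeal (A.Z.presheaf.stalk (π ξ'))).spanFinrank = Fintype.card (Option (Fin n)) := by
    rw [hd, Fintype.card_option, Fintype.card_fin]
  obtain ⟨i, e, τ, he, hei, hnzd, hgen, -, hdim⟩ := exists_stalk_chartData_nzd hπ ξ' c hcJ hc hd' hrat
  -- `f₀ ∈ 𝔪^p`
  have hf₀𝔪 : f₀ ∈ maximalIdeal (A.Z.presheaf.stalk (π ξ')) ^ p := by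
    have h := hξ
    change (E.b : ℕ∞) ≤ idealOrder E.J _ at h
    rw [le_idealOrder_iff, hJ, Ideal.span_singleton_le_iff_mem, hb] at h
    exact h
  -- the conclusion from chart data with a `u`-index
  have tail : ∀ (i₀ : Fin n) (e : Option (Fin n) → A'.Z.presheaf.stalk ξ')
      (τ : Option (Fin n) → A.Z.presheaf.stalk (π ξ')),
      (∀ j, (π.stalkMap ξ').hom (c j) = (π.stalkMap ξ').hom (c (some i₀)) * e j) →
      (π.stalkMap ξ').hom (c (some i₀)) ∈ nonZeroDivisors (A'.Z.presheaf.stalk ξ') →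
      Ideal.span (Set.range fun j : Option (Fin n) => if j = some i₀ then (π.stalkMap ξ').hom (c (some i₀))
        else e j - (π.stalkMap ξ').hom (τ j)) = maximalIdeal (A'.Z.presheaf.stalk ξ') →
      ∃ (i₀ : Fin n) (t : Fin n → K)
        (E₀' : AdicCompletion (maximalIdeal (A'.Z.presheaf.stalk ξ')) (A'.Z.presheaf.stalk ξ') ≃+*
          MvPowerSeries (Option (Fin n)) K)
        (f₀' : A'.Z.presheaf.stalk ξ') (w' : MvPowerSeries (Option (Fin n)) K),
        stalkIdeal (E.transform π D).J ξ' = Ideal.span {f₀'} ∧ IsUnit w' ∧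
          E₀' (algebraMap _ _ f₀') =
            w' * ((X none : MvPowerSeries (Option (Fin n)) K) ^ p -
              rename (some : Fin n → Option (Fin n)) (ser p n K (step p n K i₀ t a))) := by
    intro i₀ e τ he hnzd hgen
    obtain ⟨f', hf'⟩ := exists_eq_pow_mul_of_mem_pow (π.stalkMap ξ').hom c hc (some i₀) e he hf₀𝔪
    have hJ' : stalkIdeal (E.transform π D).J ξ' = Ideal.span {f'} :=
      stalkIdeal_transform_eq_span hπ ξ' c hcJ (some i₀) e he hnzd E f₀ hJ f' (by rw [hb]; exact hf')
    have hf'𝔪 : f' ∈ maximalIdeal (A'.Z.presheaf.stalk ξ') := by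
      have h := (mem_sing_transform_iff E ξ' f' hJ').mp hξ'
      rw [hb] at h
      exact Ideal.pow_le_self hp.ne_zero h
    obtain ⟨E', w', hw', -, hE'⟩ := exists_ringEquiv_transform_atom (π.stalkMap ξ').hom hg E₀ c hc hcX i₀ e he τ
      hgen hrat hdim a hM f₀ w hw hf₀ f' hf' hf'𝔪
    exact ⟨i₀, _, E', f', w', hJ', hw', hE'⟩
  -- case on the chart index
  cases i with
  | some i₀ => exact tail i₀ e τ he hnzd hgen
  | none =>
    obtain ⟨f', hf'⟩ := exists_eq_pow_mul_of_mem_pow (π.stalkMap ξ').hom c hc none e he hf₀𝔪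
    have hJ' : stalkIdeal (E.transform π D).J ξ' = Ideal.span {f'} :=
      stalkIdeal_transform_eq_span hπ ξ' c hcJ none e he hnzd E f₀ hJ f' (by rw [hb]; exact hf')
    have hf'𝔪 : f' ∈ maximalIdeal (A'.Z.presheaf.stalk ξ') := by
      have h := (mem_sing_transform_iff E ξ' f' hJ').mp hξ'
      rw [hb] at h
      exact Ideal.pow_le_self hp.ne_zero h
    -- the `z`-chart point is not singular: some `τ̃_{j₀}` is a unit
    by_cases hτ : ∀ j : Fin n, τ (some j) ∈ maximalIdeal (A.Z.presheaf.stalk (π ξ'))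
    · exact absurd hf'𝔪 (not_mem_maximalIdeal_transform_of_zChart (π.stalkMap ξ').hom hg E₀ c hc hcX e he τ
        hgen hrat hdim hτ a hM f₀ w hw hf₀ f' hf')
    · simp only [not_forall] at hτ
      obtain ⟨j₀, hj₀⟩ := hτ
      have hu : IsUnit (τ (some j₀)) := (IsLocalRing.notMem_maximalIdeal).mp hj₀
      obtain ⟨e', τ', he', -, hgen'⟩ := exists_chartData_reindex (π.stalkMap ξ').hom c none e he hei τ hgen
        (some j₀) (Option.some_ne_none j₀) hu
      -- the new exceptional parameter is a non-zero-divisor: `g c_{j₀} = g c_none · e_{j₀}` with `e_{j₀}` a unit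
      have hej₀ : IsUnit (e (some j₀)) := by
        refine isUnit_of_sub_mem_maximalIdeal (hu.map (π.stalkMap ξ').hom) ?_
        rw [← hgen]
        exact Ideal.subset_span ⟨some j₀, by dsimp only; rw [if_neg (Option.some_ne_none j₀)]⟩
      have hnzd' : (π.stalkMap ξ').hom (c (some j₀)) ∈ nonZeroDivisors (A'.Z.presheaf.stalk ξ') := by
        rw [he (some j₀)]
        exact mul_mem hnzd hej₀.mem_nonZeroDivisors
      exact tail j₀ e' τ' he' hnzd' hgen'


/-- [OURS · L1 W4.6 — the ONE STEP over a FINITE field; NOT a statement of the manuscript] As p523688's one step, for a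
FINITE field `K` of characteristic `p`, given that the local ring at the next singular point `ξ′` is presented too (its
residue field is `K`, e.g. from the regime at the next stage): rationality is automatic (brick 16). [folklore] -/
theorem exists_presentation_transform_of_finite [Finite K] {A A' : AmbientDatum p K} (π : A'.Z ⟶ A.Z) (D : Closeds A.Z)
    (hπ : IsBlowup π (vanishingIdeal D)) {E : IdealExponent A.Z} (hb : E.b = p)
    (hS : E.sing.Subsingleton)
    {ξ : A.Z} (hξ : ξ ∈ E.sing) (hD : (D : Set A.Z) = {ξ}) (hd : (maximalIdeal (A.Z.presheaf.stalk ξ)).spanFinrank = n + 1)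
    (E₀ : AdicCompletion (maximalIdeal (A.Z.presheaf.stalk ξ)) (A.Z.presheaf.stalk ξ) ≃+*
      MvPowerSeries (Option (Fin n)) K)
    (f₀ : A.Z.presheaf.stalk ξ) (a : (Fin n → ℕ) → K) (w : MvPowerSeries (Option (Fin n)) K)
    (hJ : stalkIdeal E.J ξ = Ideal.span {f₀}) (hw : IsUnit w)
    (hf₀ : E₀ (algebraMap _ _ f₀) =
      w * ((X none : MvPowerSeries (Option (Fin n)) K) ^ p - rename (some : Fin n → Option (Fin n)) (ser p n K a)))
    (hM : MultP p n K a)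
    {ξ' : A'.Z} (hξ' : ξ' ∈ (E.transform π D).sing)
    (hres' : Nonempty (ResidueField (A'.Z.presheaf.stalk ξ') ≃+* K)) :
    ∃ (i₀ : Fin n) (t : Fin n → K)
      (E₀' : AdicCompletion (maximalIdeal (A'.Z.presheaf.stalk ξ')) (A'.Z.presheaf.stalk ξ') ≃+*
        MvPowerSeries (Option (Fin n)) K)
      (f₀' : A'.Z.presheaf.stalk ξ') (w' : MvPowerSeries (Option (Fin n)) K),
      stalkIdeal (E.transform π D).J ξ' = Ideal.span {f₀'} ∧ IsUnit w' ∧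
        E₀' (algebraMap _ _ f₀') =
          w' * ((X none : MvPowerSeries (Option (Fin n)) K) ^ p -
            rename (some : Fin n → Option (Fin n)) (ser p n K (step p n K i₀ t a))) := by
  haveI : IsLocallyNoetherian A'.Z := ambient_isLocallyNoetherian A'
  -- `ξ′` lies over the singular point
  have hDS : (D : Set A.Z) ⊆ E.sing := by
    rw [hD]
    exact Set.singleton_subset_iff.mpr hξ
  have hπξ : π ξ' = ξ := hS (sing_subset_of_transform hπ E hDS hξ') hξ
  subst hπξ
  haveI : IsRegularLocalRing (A.Z.presheaf.stalk (π ξ')) := ambient_isRegular A _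
  haveI : IsRegularLocalRing (A'.Z.presheaf.stalk ξ') := ambient_isRegular A' _
  -- both residue fields are `K`; over a finite field the residue extension is bijective
  obtain ⟨eR⟩ := nonempty_residueField_equiv_of_presentation E₀
  obtain ⟨eS⟩ := hres'
  have hrat : ∀ y : A'.Z.presheaf.stalk ξ', ∃ r : A.Z.presheaf.stalk (π ξ'),
      y - (π.stalkMap ξ').hom r ∈ maximalIdeal (A'.Z.presheaf.stalk ξ') := fun y =>
    exists_sub_map_mem_maximalIdeal_of_finite (π.stalkMap ξ').hom eR eS y
  exact exists_presentation_transform_of_rat π D hπ hb hS hξ hD hd E₀ f₀ a w hJ hw hf₀ hM hξ' hrat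


end CampaignW46.ForcedAtom

end Summit.ResolutionOfSingularities.ResolutionOfSingularities.Theorems

end
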